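import Literature.NumberTheory.DiophantineGeometry.GenEllPhiMechanism
import HarnessLib

/-!
# [GenEll] Thm. 2.1 (ii) ⇒ (i) for `ℙ¹`: the `ε`-FLOOR of the noncritical-Belyi mechanism on a fixed
# cover (why `e` is chosen after `ε`, and why no transfer of unbounded degree can follow it)

S. Mochizuki, *Arithmetic elliptic curves in general position*, Math. J. Okayama Univ. 52 (2010)
[cite: MochizukiGenEll2010, Thm 2.1 p.12]: "(1+ε′)² ≤ 1+ε … for `e` sufficiently large" — the auxiliary
cover of degree `e` is chosen AFTER `ε`, because the Riemann–Hurwitz loss `e/(e−3)` of the cover is the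
floor of what the mechanism can deliver. In the tree's bookkeeping theorem
`vojtaIneq_of_belyi_mechanism` (abc-iut-S6, `GenEllPhiMechanism`) this floor is visible in the two
slope hypotheses `0 < A − (1+ε′)·B_c` and `(1+ε′)/(A − (1+ε′)·B_c) ≤ 1+ε` with `A − B_c = (e−3)/e`
(`slope_sub_eq`). This proof-only file records, kernel-checked, the two elementary consequences used
in the architecture review of the `GenEllTwo` assembly (abc-iut cell, referee findings F1 / F-SPINE,
2026-08-26):

* `inv_slope_lt_of_mechanism_hyps` — the hypotheses force `1/(A − B_c) < 1 + ε` whenever `B_c > 0`,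
  `ε′ > 0`; with `A − B_c = (e−3)/e`: `e/(e−3) < 1+ε` (`floor_of_mechanism_hyps`). So on a FIXED cover
  the mechanism yields Vojta's inequality only for `ε > 3/(e−3)`, never "for every `ε > 0`".
* `transfer_factor_neg` — consequently a subsequent transfer along a self-map of `ℙ¹` of degree
  `n` with loss factor `1 − ε″(n−1)`, fed by the mechanism's `ε″ > 3/(e−3)`, is void as soon as
  `n − 1 ≥ (e−3)/3`: the loss factor is `< 0`.

Pure real arithmetic; theorems only; classical; nothing here bears on [IUTchIII] Cor. 3.12.
-/

noncomputable section

namespace Literature.NumberTheory.DiophantineGeometry.GenEll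

/-- **The `ε`-floor of the mechanism.** If `B_c > 0`, `ε′ > 0`, `0 < A − (1+ε′)·B_c` and
`(1+ε′)/(A − (1+ε′)·B_c) ≤ 1 + ε` (the two slope hypotheses of `vojtaIneq_of_belyi_mechanism`), then
`1/(A − B_c) < 1 + ε`. [cite: MochizukiGenEll2010, Thm 2.1 p.12] -/
theorem inv_slope_lt_of_mechanism_hyps {A Bc ε ε' : ℝ} (hBc : 0 < Bc) (hε' : 0 < ε')
    (hslope : 0 < A - (1 + ε') * Bc) (hε : (1 + ε') / (A - (1 + ε') * Bc) ≤ 1 + ε) :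
    1 / (A - Bc) < 1 + ε := by
  have hlt : A - (1 + ε') * Bc < A - Bc := by nlinarith
  have hpos : 0 < A - Bc := lt_trans hslope hlt
  -- 1/(A - Bc) < 1/(A - (1+ε')Bc) ≤ (1+ε')/(A - (1+ε')Bc) ≤ 1 + ε
  have h1 : 1 / (A - Bc) < 1 / (A - (1 + ε') * Bc) :=
    one_div_lt_one_div_of_lt hslope hlt
  have h2 : 1 / (A - (1 + ε') * Bc) ≤ (1 + ε') / (A - (1 + ε') * Bc) :=
    div_le_div_of_nonneg_right (by linarith) hslope.le
  linarith

/-- **The floor in terms of `e`.** With `A = deg β·(e+3)/e` and `B_c = ((deg β + 2)(e+3) − 3e − 3)/e`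
(so `A − B_c = (e−3)/e`, `slope_sub_eq`), `deg β ≥ 1` and `e > 3`, the slope hypotheses of
`vojtaIneq_of_belyi_mechanism` force `e/(e−3) < 1 + ε`: the mechanism on the fixed cover `D_e` cannot
deliver Vojta's inequality with `1 + ε ≤ e/(e−3)`. (This is why [GenEll] p. 12 takes "`e` sufficiently
large" AFTER `ε`.) [cite: MochizukiGenEll2010, Thm 2.1 p.12] -/
theorem floor_of_mechanism_hyps {degβ e ε ε' : ℝ} (hdeg : 1 ≤ degβ) (he : 3 < e) (hε' : 0 < ε')
    (hslope : 0 < degβ * (e + 3) / e - (1 + ε') * (((degβ + 2) * (e + 3) - 3 * e - 3) / e))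
    (hε : (1 + ε') / (degβ * (e + 3) / e - (1 + ε') * (((degβ + 2) * (e + 3) - 3 * e - 3) / e))
      ≤ 1 + ε) :
    e / (e - 3) < 1 + ε := by
  have he0 : e ≠ 0 := by linarith
  have hBc : 0 < ((degβ + 2) * (e + 3) - 3 * e - 3) / e := by
    apply div_pos _ (by linarith)
    nlinarith
  have h := inv_slope_lt_of_mechanism_hyps hBc hε' hslope hε
  rw [slope_sub_eq degβ e he0, one_div_div] at h
  exact h

/-- **No transfer of large degree after the mechanism.** If the mechanism's output `ε″` satisfies
`3/(e−3) < ε″` (the floor above) and the transfer map has degree `n` with `(e−3)/3 ≤ n − 1`, then the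
transfer's loss factor `1 − ε″·(n−1)` is `< 0`: the transferred inequality
`(1 − ε″(n−1))·ht ≤ (1+ε″)(log-diff + log-cond) + C` is void. [cite: MochizukiGenEll2010, Thm 2.1 p.12] -/
theorem transfer_factor_neg {e ε'' n : ℝ} (he : 3 < e) (hε'' : 3 / (e - 3) < ε'')
    (hn : (e - 3) / 3 ≤ n - 1) : 1 - ε'' * (n - 1) < 0 := by
  have he3 : 0 < e - 3 := by linarith
  have h1 : 3 / (e - 3) * ((e - 3) / 3) = 1 := by
    field_simp
  have h2 : 1 < ε'' * ((e - 3) / 3) := by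
    have : 3 / (e - 3) * ((e - 3) / 3) < ε'' * ((e - 3) / 3) :=
      mul_lt_mul_of_pos_right hε'' (by positivity)
    linarith
  have h3 : ε'' * ((e - 3) / 3) ≤ ε'' * (n - 1) :=
    mul_le_mul_of_nonneg_left hn (by
      have : 0 < 3 / (e - 3) := by positivity
      linarith)
  linarith

end Literature.NumberTheory.DiophantineGeometry.GenEll

end
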